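import Summits.ResolutionOfSingularities.ResolutionOfSingularities.Theorems.LossEntryW34
import Summits.ResolutionOfSingularities.ResolutionOfSingularities.Theorems.WildDescent14
import HarnessLib

/-!
# LossEntryW35 — HYP-FREE BY-NAME READINGS after the lossy cell (decomp-res lens-3 g29, node «LossEntryWalk», part W35′)

`LossEntryW33.lean` decides the LOSSY strict cell hypothesis-free
(`LossEpisode.noLossyStrictTailsDeep : WallCut.NoLossyStrictTailsDeep`).  The tree ALREADY holds, hypothesis-free,
`WildDescent.defectWalksDeep_iff_lossy : MaxContactCut.DefectWalksDeep ↔ WallCut.NoLossyStrictTailsDeep`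
(`Theorems/WildDescent14.lean`, built on `WallFrames.balancedWallPort_holds : WallCut.BalancedWallPort`,
`Theorems/WallFrames16.lean`), and both δ-balanced strict cells (`WallFrames.noTameBalancedStrictTailsDeep_holds`,
`WildDescent.noWildBalancedStrictTailsDeep_holds` — cited, not restated).  Composing these with the landed unconditional
directions gives four class statements HYPOTHESIS-FREE and BY NAME in the `WallCut` namespace, for citation:
`noSmallDeadStrictHighSkewJointTailsDeep_holds`, `noHighSkewJointTailsDeep_holds`, `noSkewJointTailsDeep_holds`
(lens-5's coefficient class), `noMonomialRegimeSkewStalledTailsDeep_holds` (lens-5's monomial-regime class).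

The route ITEMS these classes underlie (27367 `ECNoSmallDeadStrictHighSkewJointTailsDeep`, 28122 `CFNoSkewJointTailsDeep`,
31770, 31769, …) are closed by name ELSEWHERE (`Theorems/ColumnLedger.lean`, lens-5 g40; `Theorems/DefectWalksDeepHolds.lean`,
census) per CRITIC-LEDGER letter 238l — this file deliberately states NO `Theses` decl.  Nothing here is new mathematics:
every proof is a composition of landed theorems (standard axioms only).
-/

namespace Summit.ResolutionOfSingularities.ResolutionOfSingularities.Theorems.WallCut

open Summit.ResolutionOfSingularities.ResolutionOfSingularities.Theorems.FreezeCut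

/-- **The column's residual class HOLDS, hypothesis-free:** no small-dead strict high skew joint tails. [new;
composition of `LossEpisode.noLossyStrictTailsDeep` (W33), `WildDescent.defectWalksDeep_of_lossy'` (WildDescent14) and
`ExtinctionCut.smallDeadStrict_of_defectWalksDeep`] [folklore] -/
theorem noSmallDeadStrictHighSkewJointTailsDeep_holds : NoSmallDeadStrictHighSkewJointTailsDeep :=
  ExtinctionCut.smallDeadStrict_of_defectWalksDeep
    (WildDescent.defectWalksDeep_of_lossy' LossEpisode.noLossyStrictTailsDeep)

/-- The HIGH-SKEW joint class HOLDS, hypothesis-free (port fed with `WallFrames.balancedWallPort_holds`). [new;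
composition] [folklore] -/
theorem noHighSkewJointTailsDeep_holds : NoHighSkewJointTailsDeep :=
  (highSkew_iff_wild_of_port WallFrames.balancedWallPort_holds).mpr WildDescent.noWildBalancedStrictTailsDeep_holds

/-- lens-5's SKEW COEFFICIENT class HOLDS, hypothesis-free. [new; composition] [folklore] -/
theorem noSkewJointTailsDeep_holds : CoefficientCut.NoSkewJointTailsDeep :=
  (skew_iff_wild_of_port WallFrames.balancedWallPort_holds).mpr WildDescent.noWildBalancedStrictTailsDeep_holds

/-- lens-5's MONOMIAL-REGIME skew stalled class HOLDS, hypothesis-free. [new; composition] [folklore] -/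
theorem noMonomialRegimeSkewStalledTailsDeep_holds : StallVertex.NoMonomialRegimeSkewStalledTailsDeep :=
  (monomialRegime_iff_wild_of_port WallFrames.balancedWallPort_holds).mpr WildDescent.noWildBalancedStrictTailsDeep_holds

end Summit.ResolutionOfSingularities.ResolutionOfSingularities.Theorems.WallCut
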